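import Summits.QuantumFields.YangMills.Theorems.SwapVirialDeficitBlowUpGnomonicBFibreRescaled
import Summits.QuantumFields.YangMills.Theorems.SwapVirialDeficitBlowUpGnomonicStratumBJointDiagonal
import HarnessLib

/-!
# STUB (S-B) OF SKELETON ➎, SOCKETS part 2a′: UNIFORM COERCIVITY OF THE B-FIBRE IN THE RESCALED `x₀`-LETTER on `{|u| ≥ τ}`
# (free-hands support of ⟨stmt-QuantumFields-24197⟩ `SwapVirialDeficit.SwapGluedStiffness` ∕ ⟨24194⟩; cell ym-idea-1, LEAD memo7 §E(3); w3 g66's (S-B) floor package read in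
# w2's letters of ✓`…BlowUpGnomonicBFibreRescaled`)

* `bAniso_rescaled_arith` — scalar bookkeeping;
* ★★★ `bFibQ_gnoScaleB_ge` — for principal signs (`ε_z = +`, followers `+`), `0 < τ ≤ 1`, every base `u` with `τ² ≤ |u|²` and EVERY `y ∈ V_B`:
  `τ²∕((1+τ²)·12375·L¹⁰)·‖y‖² ≤ (d²∕ds²) F_B(gnoBaseB u + s·gnoFibreBEmb (gnoScaleB u y))|₀` — w3 g66's ✓`fibre_raySecond_ge_stratumB_joint_diag` at the END hub `hubAt 0 1`
  (`re = 0`, `‖im‖ = 1`), `δ := −y_δ`, direction blocks `d = (√(1+|u|²)x₀, (y₀,v₀,v₁), z, η_F)`, read on the B-ray through ✓`bDeficit_ray_eq_hubLine`; i.e. the `hcoer` socket of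
  ✓`bTube_fibred_cylinder` for the rescaled operators `A′_u = D_u A_u D_u` with `λ_B(τ) = τ²∕((1+τ²)·12375·L¹⁰)`, UNIFORM on `S = {|u| ≥ τ}` (no cap on `|u|`).

HONEST LABEL: (S-B), (S-core), (S-001), ⟨24197⟩ ∕ ⟨24194⟩ OPEN; own crux ⟨22884⟩ OPEN (blocked-on ⟨19935⟩); the Yang–Mills mass gap is NOT proved; no summit is proved by a line.
THEOREMS ONLY (0 `def`, 0 `sorry`), standard axioms.  Width seat ym-line-sfw-p2-w2 g59 (cell ym-idea-1, free hands), `--supports stmt-QuantumFields-24197`.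
References: [cite: Luscher1983, §2]; [folklore].
-/

set_option autoImplicit false
set_option synthInstance.maxSize 1024

noncomputable section

open MeasureTheory Quaternion Set Metric
open scoped BigOperators Quaternion InnerProductSpace ENNReal
open Literature.MathematicalPhysics.QuantumFieldTheory hiding SU2
open Literature.MathematicalPhysics.QuantumLattice

namespace Summit.QuantumFields.YangMills.Theorems.SwapVirialDeficit.BlowUpRing

open Summit.QuantumFields.YangMills.Theorems.FemtoTransferGap
open Summit.QuantumFields.YangMills.Theorems.FemtoTransferGap.TT
open Summit.QuantumFields.YangMills.Theorems.VirialFluxGap.RingDeficit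
open Summit.QuantumFields.YangMills.Theorems.SwapVirialDeficit.SwapRing
open Summit.QuantumFields.YangMills.Theorems.SwapVirialDeficit.Gnomonic (normSq3 normSq3_nonneg)

variable {L : ℕ} [NeZero L]

/-! ## §3 Uniform coercivity of the B-ray second derivative in the rescaled letter -/

omit [NeZero L] in
/-- Scalar bookkeeping for `bFibQ_gnoScaleB_ge`: with `s = |u|²∕(1+|u|²) ≥ t = τ²∕(1+τ²)`, `t ≤ 1∕2`, `1 ≤ ℓ`, `0 < card ≤ 6ℓ⁴`, the five (weakened) terms of w3's
joint-diagonal floor in the rescaled letter (`109∕165` on the middle three) dominate `t∕(12375ℓ¹⁰)·(D + X + Y + V + Z + F)`. [folklore] -/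
theorem bAniso_rescaled_arith {t s D X Y V Z F ℓ card : ℝ} (ht0 : 0 ≤ t) (hts : t ≤ s) (hs1 : s ≤ 1) (ht1 : t ≤ 1 / 2) (hℓ : 1 ≤ ℓ) (hcard : 0 < card)
    (hcard' : card ≤ 6 * ℓ ^ 4) (hD : 0 ≤ D) (hX : 0 ≤ X) (hY : 0 ≤ Y) (hV : 0 ≤ V) (hZ : 0 ≤ Z) (hF : 0 ≤ F) :
    t / (12375 * ℓ ^ 10) * (D + X + Y + V + Z + F) ≤
      s * X / (12375 * ℓ ^ 6) + 109 / 165 * ((16 * s * D + 4 * V) / (16200 * ℓ ^ 6) + 2 * F / (2304 * ℓ ^ 6 * card) + s * Y / (450 * ℓ ^ 6)) +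
        Z / (12150 * ℓ ^ 6) := by
  have hℓ0 : 0 < ℓ := by linarith
  have hℓ6 : 0 < ℓ ^ 6 := by positivity
  have hℓ4 : 1 ≤ ℓ ^ 4 := one_le_pow₀ hℓ
  have hℓ10 : ℓ ^ 10 = ℓ ^ 6 * ℓ ^ 4 := by ring
  have hs0 : 0 ≤ s := ht0.trans hts
  -- `t/(12375 ℓ¹⁰) ≤ t/(12375 ℓ⁶)` and then termwise
  have hkey : t / (12375 * ℓ ^ 10) ≤ t / (12375 * ℓ ^ 6) := by
    rw [hℓ10]
    apply div_le_div_of_nonneg_left ht0 (by positivity)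
    nlinarith
  have hkF : t / (12375 * ℓ ^ 10) ≤ 109 / 165 * (2 / (2304 * ℓ ^ 6 * card)) := by
    rw [← mul_div_assoc, div_le_div_iff₀ (by positivity) (by positivity), hℓ10]
    nlinarith [mul_nonneg hℓ6.le hcard.le, mul_le_mul_of_nonneg_left hcard' hℓ6.le]
  have e : t / (12375 * ℓ ^ 10) * (D + X + Y + V + Z + F) =
      t / (12375 * ℓ ^ 10) * D + t / (12375 * ℓ ^ 10) * X + t / (12375 * ℓ ^ 10) * Y + t / (12375 * ℓ ^ 10) * V + t / (12375 * ℓ ^ 10) * Z +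
        t / (12375 * ℓ ^ 10) * F := by ring
  rw [e]
  have h1 : t / (12375 * ℓ ^ 10) * X ≤ s * X / (12375 * ℓ ^ 6) := by
    calc t / (12375 * ℓ ^ 10) * X ≤ t / (12375 * ℓ ^ 6) * X := mul_le_mul_of_nonneg_right hkey hX
      _ ≤ s / (12375 * ℓ ^ 6) * X := mul_le_mul_of_nonneg_right (div_le_div_of_nonneg_right hts (by positivity)) hX
      _ = s * X / (12375 * ℓ ^ 6) := by ring
  have h2 : t / (12375 * ℓ ^ 10) * D ≤ 109 / 165 * (16 * s * D) / (16200 * ℓ ^ 6) := by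
    calc t / (12375 * ℓ ^ 10) * D ≤ t / (12375 * ℓ ^ 6) * D := mul_le_mul_of_nonneg_right hkey hD
      _ ≤ s / (12375 * ℓ ^ 6) * D := mul_le_mul_of_nonneg_right (div_le_div_of_nonneg_right hts (by positivity)) hD
      _ ≤ 109 / 165 * (16 * s * D) / (16200 * ℓ ^ 6) := by
          rw [div_mul_eq_mul_div, div_le_div_iff₀ (by positivity) (by positivity)]
          nlinarith [mul_nonneg hs0 hD, hℓ6]
  have h3 : t / (12375 * ℓ ^ 10) * V ≤ 109 / 165 * (4 * V) / (16200 * ℓ ^ 6) := by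
    calc t / (12375 * ℓ ^ 10) * V ≤ t / (12375 * ℓ ^ 6) * V := mul_le_mul_of_nonneg_right hkey hV
      _ ≤ (1 / 2) / (12375 * ℓ ^ 6) * V := mul_le_mul_of_nonneg_right (div_le_div_of_nonneg_right ht1 (by positivity)) hV
      _ ≤ 109 / 165 * (4 * V) / (16200 * ℓ ^ 6) := by
          rw [div_mul_eq_mul_div, div_le_div_iff₀ (by positivity) (by positivity)]
          nlinarith [hV, hℓ6]
  have h4 : t / (12375 * ℓ ^ 10) * Y ≤ 109 / 165 * (s * Y / (450 * ℓ ^ 6)) := by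
    calc t / (12375 * ℓ ^ 10) * Y ≤ t / (12375 * ℓ ^ 6) * Y := mul_le_mul_of_nonneg_right hkey hY
      _ ≤ s / (12375 * ℓ ^ 6) * Y := mul_le_mul_of_nonneg_right (div_le_div_of_nonneg_right hts (by positivity)) hY
      _ ≤ 109 / 165 * (s * Y / (450 * ℓ ^ 6)) := by
          rw [div_mul_eq_mul_div, ← mul_div_assoc, div_le_div_iff₀ (by positivity) (by positivity)]
          nlinarith [mul_nonneg hs0 hY, hℓ6]
  have h5 : t / (12375 * ℓ ^ 10) * Z ≤ Z / (12150 * ℓ ^ 6) := by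
    calc t / (12375 * ℓ ^ 10) * Z ≤ t / (12375 * ℓ ^ 6) * Z := mul_le_mul_of_nonneg_right hkey hZ
      _ ≤ (1 / 2) / (12375 * ℓ ^ 6) * Z := mul_le_mul_of_nonneg_right (div_le_div_of_nonneg_right ht1 (by positivity)) hZ
      _ ≤ Z / (12150 * ℓ ^ 6) := by
          rw [div_mul_eq_mul_div, div_le_div_iff₀ (by positivity) (by positivity)]
          nlinarith [hZ, hℓ6]
  have h6 : t / (12375 * ℓ ^ 10) * F ≤ 109 / 165 * (2 * F / (2304 * ℓ ^ 6 * card)) := by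
    calc t / (12375 * ℓ ^ 10) * F ≤ 109 / 165 * (2 / (2304 * ℓ ^ 6 * card)) * F := mul_le_mul_of_nonneg_right hkF hF
      _ = 109 / 165 * (2 * F / (2304 * ℓ ^ 6 * card)) := by ring
  have esplit : 109 / 165 * ((16 * s * D + 4 * V) / (16200 * ℓ ^ 6) + 2 * F / (2304 * ℓ ^ 6 * card) + s * Y / (450 * ℓ ^ 6)) =
      109 / 165 * (16 * s * D) / (16200 * ℓ ^ 6) + 109 / 165 * (4 * V) / (16200 * ℓ ^ 6) + 109 / 165 * (2 * F / (2304 * ℓ ^ 6 * card)) +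
        109 / 165 * (s * Y / (450 * ℓ ^ 6)) := by
    ring
  rw [esplit]
  linarith

/-- ★★★ **UNIFORM COERCIVITY OF THE B-RAY SECOND DERIVATIVE IN THE RESCALED LETTER** (principal signs `ε_z = +`, followers `+`): for `0 < τ ≤ 1`, every base `u`
with `τ² ≤ |u|²` and EVERY `y ∈ V_B`,
`τ²∕((1+τ²)·12375·L¹⁰)·‖y‖² ≤ (d²∕ds²) F_B(gnoBaseB u + s·gnoFibreBEmb (gnoScaleB u y))|₀`
— w3 g66's ✓`fibre_raySecond_ge_stratumB_joint_diag` at the end hub `a = hubAt 0 1` (`re a = 0`, `‖im a‖ = 1`) with `δ := −y_δ` and direction blocks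
`d = (√(1+|u|²)x₀, (y₀, v₀, v₁), z, η_F)`, read on the B-ray through ✓`bDeficit_ray_eq_hubLine`, the cross term `(u₁v₁ − u₂v₀)²` dropped (coefficients: `x₀′ ↦ s∕12375L⁶`,
`δ ↦ (109∕165)·16s∕16200L⁶`, `y_⊥ ↦ (109∕165)·4∕16200L⁶`, `F ↦ (109∕165)·2∕(2304L⁶|Fol|)`, `y₀ ↦ (109∕165)·s∕450L⁶`, `z ↦ 1∕12150L⁶`, `s = |u|²∕(1+|u|²) ≥ τ²∕(1+τ²)`).
[cite: Luscher1983, §2] -/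
theorem bFibQ_gnoScaleB_ge (ε : GnoSign L) (hz : ε.2.1 = true) (hε : ε.2.2 = fun _ => true) {τ : ℝ} (hτ : 0 < τ) (hτ1 : τ ≤ 1)
    (u : ℝ × ℝ) (hu : τ ^ 2 ≤ u.1 ^ 2 + u.2 ^ 2) (y : GnoFibreB L) :
    τ ^ 2 / ((1 + τ ^ 2) * (12375 * (L : ℝ) ^ 10)) * ‖y‖ ^ 2 ≤
      iteratedDeriv 2 (fun s : ℝ => gnoDeficit (fun _ => false) (fun _ => 1) (hubAt (gnoBaseB u + s • gnoFibreBEmb (gnoScaleB u y)).1 1) ε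
        (gnoBaseB u + s • gnoFibreBEmb (gnoScaleB u y)).2) 0 := by
  have hL1nat : 1 ≤ L := NeZero.one_le
  have hL1 : (1 : ℝ) ≤ (L : ℝ) := by exact_mod_cast hL1nat
  have hcard : 0 < (Fintype.card (Fol L) : ℝ) := by
    have h : 0 < Fintype.card (Fol L) := by rw [card_fol]; have := Nat.one_le_pow 4 L hL1nat; omega
    exact_mod_cast h
  have hcard' : (Fintype.card (Fol L) : ℝ) ≤ 6 * (L : ℝ) ^ 4 := by
    rw [card_fol]
    have h : (6 * L ^ 4 - 3 : ℕ) ≤ 6 * L ^ 4 := Nat.sub_le _ _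
    exact_mod_cast h
  have hL0 : (0 : ℝ) < L := by linarith
  have hL6 : (0 : ℝ) < (L : ℝ) ^ 6 := by positivity
  -- base scalars first (all positivity ∕ nlinarith BEFORE the fibre letters and the heavy hypotheses enter the context)
  obtain ⟨U, hU⟩ : ∃ r : ℝ, r = u.1 ^ 2 + u.2 ^ 2 := ⟨_, rfl⟩
  have hU0 : 0 ≤ U := by rw [hU]; positivity
  have hU1 : 0 < 1 + U := by positivity
  have hτU : τ ^ 2 ≤ U := by rw [hU]; exact hu
  have hτ2 : 0 < τ ^ 2 := by positivity
  obtain ⟨c, hc⟩ : ∃ r : ℝ, r = Real.sqrt (1 + (u.1 ^ 2 + u.2 ^ 2)) := ⟨_, rfl⟩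
  have hc2 : c ^ 2 = 1 + U := by rw [hc, hU]; exact Real.sq_sqrt (by positivity)
  obtain ⟨s, hs⟩ : ∃ r : ℝ, r = U / (1 + U) := ⟨_, rfl⟩
  have hs1 : s ≤ 1 := by rw [hs, div_le_one hU1]; linarith
  have hts : τ ^ 2 / (1 + τ ^ 2) ≤ s := by
    rw [hs, div_le_div_iff₀ (by positivity) hU1]; nlinarith [hτU]
  have ht0 : 0 ≤ τ ^ 2 / (1 + τ ^ 2) := by positivity
  have ht1 : τ ^ 2 / (1 + τ ^ 2) ≤ 1 / 2 := by
    rw [div_le_div_iff₀ (by positivity) (by positivity)]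
    have hτ4 : τ ^ 2 ≤ 1 := by nlinarith
    linarith
  have h450 : (0 : ℝ) < 450 * (L : ℝ) ^ 6 * (1 + U) := by positivity
  have h450' : (0 : ℝ) < 450 * (L : ℝ) ^ 6 := by positivity
  -- fibre letters
  obtain ⟨D, hD⟩ : ∃ r : ℝ, r = y (Sum.inl (Sum.inl 0)) ^ 2 := ⟨_, rfl⟩
  obtain ⟨X, hX⟩ : ∃ r : ℝ, r = y (Sum.inl (Sum.inl 1)) ^ 2 := ⟨_, rfl⟩
  obtain ⟨Y, hY⟩ : ∃ r : ℝ, r = y (Sum.inl (Sum.inl 2)) ^ 2 := ⟨_, rfl⟩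
  obtain ⟨V, hV⟩ : ∃ r : ℝ, r = y (Sum.inl (Sum.inr 0)) ^ 2 + y (Sum.inl (Sum.inr 1)) ^ 2 := ⟨_, rfl⟩
  obtain ⟨Z, hZ⟩ : ∃ r : ℝ, r = normSq3 (fun k => y (Sum.inr (Sum.inl k))) := ⟨_, rfl⟩
  obtain ⟨F, hF⟩ : ∃ r : ℝ, r = ∑ f, normSq3 (fun k => y (Sum.inr (Sum.inr (f, k)))) := ⟨_, rfl⟩
  have hD0 : 0 ≤ D := by rw [hD]; exact sq_nonneg _
  have hX0 : 0 ≤ X := by rw [hX]; exact sq_nonneg _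
  have hY0 : 0 ≤ Y := by rw [hY]; exact sq_nonneg _
  have hV0 : 0 ≤ V := by rw [hV]; exact add_nonneg (sq_nonneg _) (sq_nonneg _)
  have hZ0 : 0 ≤ Z := by rw [hZ]; exact normSq3_nonneg _
  have hF0 : 0 ≤ F := by rw [hF]; exact Finset.sum_nonneg fun f _ => normSq3_nonneg _
  -- the norm in letters
  have hN : ‖y‖ ^ 2 = D + X + Y + V + Z + F := by rw [norm_sq_gnoFibreB_letters, hD, hX, hY, hV, hZ, hF]; ring
  -- w3's direction blocks
  obtain ⟨d, hd⟩ : ∃ d : ℝ × (Fin 3 → ℝ) × (Fin 3 → ℝ) × (Fol L → Fin 3 → ℝ),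
      d = (c * y (Sum.inl (Sum.inl 1)), ((![y (Sum.inl (Sum.inl 2)), y (Sum.inl (Sum.inr 0)), y (Sum.inl (Sum.inr 1))] : Fin 3 → ℝ),
        ((fun k => y (Sum.inr (Sum.inl k))), (fun f k => y (Sum.inr (Sum.inr (f, k))))))) := ⟨_, rfl⟩
  -- w3's five terms in the scalar names (the cross term dropped)
  have hT1 : (u.1 ^ 2 + u.2 ^ 2) * d.1 ^ 2 / (12375 * (L : ℝ) ^ 6 * (1 + (u.1 ^ 2 + u.2 ^ 2)) ^ 2) = s * X / (12375 * (L : ℝ) ^ 6) := by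
    have e1 : d.1 ^ 2 = c ^ 2 * X := by rw [hd, hX]; ring
    rw [e1, hc2, ← hU, hs]
    have h1 : (1 + U) ≠ 0 := hU1.ne'
    field_simp
  have hT2 : (((4 * (-y (Sum.inl (Sum.inl 0))) ^ 2 / (1 : ℝ) ^ 2) * (4 * (u.1 ^ 2 + u.2 ^ 2) / (1 + (u.1 ^ 2 + u.2 ^ 2)))) +
      4 * (d.2.1 1 ^ 2 + d.2.1 2 ^ 2)) / (16200 * (L : ℝ) ^ 6) = (16 * s * D + 4 * V) / (16200 * (L : ℝ) ^ 6) := by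
    have e1 : d.2.1 1 ^ 2 + d.2.1 2 ^ 2 = V := by rw [hd, hV]; simp
    rw [e1, ← hU, hs, neg_sq, ← hD]
    ring
  have hT3 : (∑ f, 2 * normSq3 (d.2.2.2 f)) / (2304 * (L : ℝ) ^ 6 * (Fintype.card (Fol L) : ℝ)) = 2 * F / (2304 * (L : ℝ) ^ 6 * (Fintype.card (Fol L) : ℝ)) := by
    rw [hF, Finset.mul_sum, hd]
  have hT4 : s * Y / (450 * (L : ℝ) ^ 6) ≤
      ((u.1 * d.2.1 2 - u.2 * d.2.1 1) ^ 2 + (u.2 * d.2.1 0) ^ 2 + (u.1 * d.2.1 0) ^ 2) / (450 * (L : ℝ) ^ 6 * (1 + (u.1 ^ 2 + u.2 ^ 2))) := by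
    have e0 : d.2.1 0 = y (Sum.inl (Sum.inl 2)) := by rw [hd]; simp
    have e1 : (u.2 * d.2.1 0) ^ 2 + (u.1 * d.2.1 0) ^ 2 = U * Y := by rw [e0, hU, hY]; ring
    have hx : 0 ≤ (u.1 * d.2.1 2 - u.2 * d.2.1 1) ^ 2 := sq_nonneg _
    rw [add_assoc, e1, ← hU]
    have e2 : s * Y / (450 * (L : ℝ) ^ 6) = U * Y / (450 * (L : ℝ) ^ 6 * (1 + U)) := by
      rw [hs]
      have h1 : (1 + U) ≠ 0 := hU1.ne'
      field_simp
    rw [e2]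
    exact div_le_div_of_nonneg_right (by linarith) h450.le
  have hT5 : normSq3 d.2.2.1 / (12150 * (L : ℝ) ^ 6) = Z / (12150 * (L : ℝ) ^ 6) := by rw [hd, hZ]
  have harith := bAniso_rescaled_arith (D := D) (X := X) (Y := Y) (V := V) (Z := Z) (F := F) ht0 hts hs1 ht1 hL1 hcard hcard' hD0 hX0 hY0 hV0 hZ0 hF0
  have e : τ ^ 2 / ((1 + τ ^ 2) * (12375 * (L : ℝ) ^ 10)) * ‖y‖ ^ 2 = τ ^ 2 / (1 + τ ^ 2) / (12375 * (L : ℝ) ^ 10) * (D + X + Y + V + Z + F) := by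
    rw [hN, div_div]
  rw [e]
  -- the ray is w3's joint hub–letter line at `a = hubAt 0 1`, `δ := −y_δ`
  have eray : (fun s : ℝ => gnoDeficit (fun _ => false) (fun _ => 1) (hubAt (gnoBaseB u + s • gnoFibreBEmb (gnoScaleB u y)).1 1) ε
      (gnoBaseB u + s • gnoFibreBEmb (gnoScaleB u y)).2) =
      fun s : ℝ => gnoDeficit (fun _ => false) (fun _ => 1) (hubAt 0 1 - (s * -y (Sum.inl (Sum.inl 0))) • (1 : ℍ)) ε
        (((((![0, u.1, u.2] : Fin 3 → ℝ), (0 : Fin 3 → ℝ)), ((0 : Fin 3 → ℝ), (0 : Fol L → Fin 3 → ℝ))) : GnoCoord L) +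
          s • ((((![d.1, 0, 0] : Fin 3 → ℝ), d.2.1), (d.2.2.1, d.2.2.2)) : GnoCoord L)) := by
    rw [bDeficit_ray_eq_hubLine, gnoFibreBEmb_gnoScaleB, hd, hc]
    rfl
  rw [eray]
  have hw3 := fibre_raySecond_ge_stratumB_joint_diag (L := L) (hubAt_one_im_ne_zero 0) hubAt_zero_one_re ε hz hε u.1 u.2 (-y (Sum.inl (Sum.inl 0))) d
  rw [norm_im_hubAt_one, hT1, hT2, hT3, hT5] at hw3
  clear eray hd hT1 hT2 hT3 hT5 e hN hD hX hY hV hZ hF hc hc2 hs hU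
  linarith [hT4]

end Summit.QuantumFields.YangMills.Theorems.SwapVirialDeficit.BlowUpRing

end
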